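import Mathlib.FieldTheory.IntermediateField.Basic
import Mathlib.FieldTheory.Galois.Basic
import Mathlib.FieldTheory.KrullTopology
import Mathlib.NumberTheory.NumberField.Basic
import Mathlib.CategoryTheory.Category.Basic
import HarnessLib

/-!
# Frobenioids I, Examples 6.1/6.3: the base category `D = B(G)⁰` as finite subextensions of a Galois extension

Mochizuki, *The geometry of Frobenioids I: the general theory*, Kyushu J. Math. **62** (2008)
293–400, Ex. 6.1 p. 109, Ex. 6.3 p. 113, Thm. 6.2 (iv) p. 111 [cite: MochizukiFrdI2008, Ex. 6.3 p.113]: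
"the connected objects of the Galois category `B(G)` … may be thought of as schemes `Spec(L)`, where `L ⊆ K̃`
is a finite extension of `K`". DEFINED here (Mathlib-only, split out of `ArithmeticFrobenioids.lean` so that
the proof seat abc-iut-L6-t10's `FinSubextCatSlim.lean` — Frobenius-slimness and the slimness criterion of
Thm. 6.2 (iv) / 6.4 (i) — lands independently of the §3/§4 chain): the category `FinSubextCat F K` of
finite-dimensional intermediate fields of `K/F` with `Hom(Spec L, Spec M) = Hom_F(M, L)`, each object a
number field when `F` is, and the subgroup `Z ⊆ Gal(K/F)` of elements commuting with an open subgroup.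
No statement of the paper is strengthened.
-/

noncomputable section

namespace Literature.AlgebraicGeometry.Frobenioids

open CategoryTheory NumberField

universe u

/-! ### The base category `D = B(G)⁰` of Examples 6.1/6.3 as finite subextensions -/

section Base

variable (F : Type u) [Field F] (K : Type u) [Field K] [Algebra F K]

/-- An object of `D = B(Gal(K/F))⁰` "thought of as `Spec(L)`, where `L ⊆ K` is a finite extension of `F`"
(FrdI Ex. 6.1 p. 109, Ex. 6.3 p. 113): a finite-dimensional intermediate field.
[cite: MochizukiFrdI2008, Ex. 6.3 p.113] -/
structure FinSubextCat : Type u where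
  /-- the intermediate field `F ⊆ L ⊆ K` -/
  L : IntermediateField F K
  /-- finiteness over `F` -/
  [fin : FiniteDimensional F L]

/-- Each object's field is finite over `F` (structure-carried instance, exposed). [cite: MochizukiFrdI2008, Ex. 6.3 p.113] -/
instance FinSubextCat.instFiniteDimensional (X : FinSubextCat F K) : FiniteDimensional F X.L := X.fin

namespace FinSubextCat

variable {F K}

/-- Morphisms `Spec L → Spec M` over `Spec F`: `F`-algebra homomorphisms `M → L` (FrdI Ex. 6.3 p. 113,
"(a) a morphism `Spec(L) → Spec(M)` over `Spec(F)`"). [cite: MochizukiFrdI2008, Ex. 6.3 p.113] -/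
@[ext] structure Hom (X Y : FinSubextCat F K) : Type u where
  /-- the underlying `F`-algebra map `M → L` -/
  toAlgHom : Y.L →ₐ[F] X.L

/-- `FinSubextCat F K` is a category (composition = composition of algebra maps in the opposite order).
[cite: MochizukiFrdI2008, Ex. 6.3 p.113] -/
instance : Category (FinSubextCat F K) where
  Hom := Hom
  id X := ⟨AlgHom.id F X.L⟩
  comp f g := ⟨f.toAlgHom.comp g.toAlgHom⟩

/-- Extensionality of morphisms. [cite: MochizukiFrdI2008, Ex. 6.3 p.113] -/
@[ext] theorem hom_ext {X Y : FinSubextCat F K} {f g : X ⟶ Y} (h : f.toAlgHom = g.toAlgHom) : f = g :=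
  Hom.ext h

/-- Each `L` is a number field when `F` is (finite over a number field).
[cite: MochizukiFrdI2008, Ex. 6.3 p.113] -/
instance numberField [NumberField F] (X : FinSubextCat F K) : NumberField X.L :=
  NumberField.of_module_finite F X.L

end FinSubextCat

/-- The subgroup `Z ⊆ G` "of elements that commute with some open subgroup of `G`" for `G = Gal(K/F)` with
its Krull topology (FrdI Thm. 6.2 (iv) p. 111, Thm. 6.4 (i) p. 114): `D` is slim iff `Z = {1}`.
[cite: MochizukiFrdI2008, Thm. 6.2 (iv) p.111] -/
def commOpenSubgroup : Set (K ≃ₐ[F] K) :=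
  {z | ∃ H : Subgroup (K ≃ₐ[F] K), IsOpen (H : Set (K ≃ₐ[F] K)) ∧ ∀ h ∈ H, z * h = h * z}

end Base

end Literature.AlgebraicGeometry.Frobenioids

end
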